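import Summits.CriticalPhenomena.PercolationContinuityZ3.Theorems.PercNearOneGluingNoHeavyQuantGatedProductHull
import Summits.CriticalPhenomena.PercolationContinuityZ3.Theorems.PercNearOneGluingNoHeavyQuantHeavyTopSDEC
import Summits.CriticalPhenomena.PercolationContinuityZ3.Theorems.PercNearOneGluingNoHeavyQuantLightSliceWideHolds
import Summits.CriticalPhenomena.PercolationContinuityZ3.Theorems.PercNearOneGluingNoHeavyQuantSliceConeForm
import HarnessLib

/-!
# QUANT lane R8: ITERATED CONVOLUTIONS OF HEAVY-TOP LAWS ARE DEC AT EVERY LAYER AND SATISFY THE FAR-RELAY ROW AT EVERY FLOOR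
# (unconditional); rows pass through gates and through common-mean mixtures

builds on p205010 (kernel theorem, internal audit signed; external expert review pending)

Support file (`--supports stmt-CriticalPhenomena-4575`), QUANT lane lead seat prim-quant-lead (gen 39); README V377–V379 / LEAD-NOTES-G39 N5–N8 in
`run/shared/lean/prim/quant/`.  Theorems only, standard axioms, no sorries; NO conjecture is used or stated.

CONTENT.  For `LawDec.HTProd y N P` (typer g35, `…QuantGatedProductHull`: `P` on `{0..N}` is an iterated convolution of heavy-top laws at floor
`0 < y < 1`, i.e. the count law of a forest of CATERPILLARS all of whose relay marginals are `≥ y`):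
* `LawDec.HTProd.top_pos_ta_decAt` — `0 < P N`, `y·N ≤ mean P`, and `DECAt y j′ N P` for EVERY layer `j′`: one factor by `decAt_of_top_ge`
  (typer g35), the convolution step by `ConvClosedT` AS A THEOREM (`decAt_lconv_of_convClosedT convClosedT_holds`, census-2 / lead 2026-08-22/23),
  layers at or above the top by Theorem A (`decAt_of_top_le`).  (Gate-stability — typer g35's conjecture `HeavyTopProductSDEC` — is NOT claimed.)
* `LawDec.HTProd.row` — the far-relay row `2j < mean P ⟹ y ≤ P{j+1..N}` at EVERY floor (`tail_ge_of_decAt`); the law-level form, for these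
  products, of census-1 g6's `Quant.far_indepLegs` (FAR for independent legs of arbitrary law).
* `LawDec.row_gate` (a gate carries a row from floor `x/s` to floor `x`: tails from `j+1 ≥ 1` never see the zero atom), `LawDec.row_mixture`
  (rows mix at a common layer), `LawDec.row_of_gatedHTProdMixture` (any finite common-mean mixture of gated heavy-top products satisfies the row at
  its floor) — the row-level engine that made the second hypothesis `HeavyTopProductSDEC` of p388237's reductions unnecessary.
* `LawDec.lconv_top`, `LawDec.ta_pointwise_of_ta` — bookkeeping.

CONTEXT (honest).  These lemmas were written for the hull programme (`FarTreeRow ⟸` a hull conjecture); the hull conjectures themselves are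
REFUTED with exact certificates (lead g39, LEAD-NOTES-G39 N6–N7): `GatedProductHull` (all floors) by the sure-root tree (0, 1/10, 9/4000, 171/2000,
3249/4000) at floor 17/20, and `GatedProductHullLight` / `GatedPairHull` (floors < 1/2) by μ = δ₁ ∗ gate_{99/100}(δ₁ ∗ R_{4/5} ∗ R_{12/25}) =
(0, 1/100, 1287/12500, 1584/3125, 1188/3125) at floor 19/40 (a sure relay forces ungated components; the vertex reduction leaves 50 extreme products;
f = (−1, 41/50, −41/50, 1, −1) separates by 77/156250).  So no reduction from those conjectures is stated here; what remains is unconditional.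
`Quant.FarTreeRow` is OPEN.  Nothing here is a published result. [this work]; the gluing rows served [cite: KozmaNitzan2024, Conjecture 3 (p. 15)];
product measure [cite: Grimmett1999, §1.3 p. 10].
-/

noncomputable section

namespace Summit.CriticalPhenomena.PercolationContinuityZ3.Theorems

namespace Quant

open Finset

namespace LawDec

/-! ### Iterated convolutions of heavy-top laws: positive top, top-affordability, DEC at EVERY layer, hence the row -/

/-- the top atom of a convolution is the product of the top atoms. [this work] -/
theorem lconv_top (M₁ M₂ : ℕ) (μ₁ μ₂ : ℕ → ℝ) :
    lconv M₁ M₂ μ₁ μ₂ (M₁ + M₂) = μ₁ M₁ * μ₂ M₂ := by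
  simp only [lconv]
  rw [Finset.sum_eq_single M₁]
  · rw [Finset.sum_eq_single M₂]
    · rw [if_pos rfl]
    · intro k hk hne
      rw [if_neg (by omega)]
    · intro hn; exact absurd (Finset.mem_range.2 (Nat.lt_succ_self M₂)) hn
  · intro i hi hne
    refine Finset.sum_eq_zero fun k hk => ?_
    rw [Finset.mem_range] at hi hk
    rw [if_neg (by omega)]
  · intro hn; exact absurd (Finset.mem_range.2 (Nat.lt_succ_self M₁)) hn

/-- pointwise top-affordability (`x·h ≤ mean` on the support) from `x·M ≤ mean` and vanishing above `M`. [this work] -/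
theorem ta_pointwise_of_ta (y : ℝ) (M : ℕ) (μ : ℕ → ℝ) (hy0 : 0 ≤ y) (hμM : ∀ h, M < h → μ h = 0)
    (hta : y * (M : ℝ) ≤ ∑ k ∈ Finset.range (M + 1), (k : ℝ) * μ k) :
    ∀ h, 0 < μ h → y * (h : ℝ) ≤ ∑ k ∈ Finset.range (M + 1), (k : ℝ) * μ k := by
  intro h hh
  have hhM : h ≤ M := by
    by_contra hc
    exact absurd (hμM h (not_le.1 hc)) (ne_of_gt hh)
  exact le_trans (mul_le_mul_of_nonneg_left (by exact_mod_cast hhM) hy0) hta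

/-- **ITERATED CONVOLUTIONS OF HEAVY-TOP LAWS ARE DEC AT EVERY LAYER (unconditionally).**  For `0 < y < 1` and `HTProd y N P`: the top atom
`P N` is positive, `y·N ≤ mean P`, and `P` is `DECAt y j′ N P` at EVERY layer `j′` — one factor by `decAt_of_top_ge` (typer g35), the
convolution step by `ConvClosedT` as a theorem (`decAt_lconv_of_convClosedT convClosedT_holds`), layers at or above the top by Theorem A
(`decAt_of_top_le`).  No gate-stability is claimed (that would be `HeavyTopProductSDEC`); none is needed for the row. [this work] -/
theorem HTProd.top_pos_ta_decAt {y : ℝ} {N : ℕ} {P : ℕ → ℝ} (h : HTProd y N P) :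
    0 < y → y < 1 →
      0 < P N ∧ y * (N : ℝ) ≤ (∑ k ∈ Finset.range (N + 1), (k : ℝ) * P k) ∧ ∀ j', DECAt y j' N P := by
  induction h with
  | @one M A hA =>
    intro hy0 hy1
    obtain ⟨hA0, hAM, hA1, htop⟩ := hA
    exact ⟨lt_of_lt_of_le hy0 htop, (sdec_of_top_ge M y A hy0 hy1 hA0 hAM hA1 htop).1,
      fun j' => decAt_of_top_ge M y A hy0 hy1 hA0 hAM hA1 htop j'⟩
  | @mul N M P A hP hA ih =>
    intro hy0 hy1
    obtain ⟨hP0, hPN, hP1⟩ := hP.lawFacts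
    obtain ⟨hA0, hAM, hA1, htopA⟩ := hA
    obtain ⟨htopP, htaP, hdecP⟩ := ih hy0 hy1
    have htaA : y * (M : ℝ) ≤ ∑ k ∈ Finset.range (M + 1), (k : ℝ) * A k :=
      (sdec_of_top_ge M y A hy0 hy1 hA0 hAM hA1 htopA).1
    have htaPA : y * ((N + M : ℕ) : ℝ) ≤ ∑ k ∈ Finset.range (N + M + 1), (k : ℝ) * lconv N M P A k := by
      rw [sum_mul_lconv N M P A hP1 hA1, Nat.cast_add, mul_add]
      exact add_le_add htaP htaA
    refine ⟨?_, htaPA, ?_⟩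
    · rw [lconv_top]; exact mul_pos htopP (lt_of_lt_of_le hy0 htopA)
    · intro j'
      by_cases hj : j' < N + M
      · exact decAt_lconv_of_convClosedT convClosedT_holds y N M P A hy0 hy1 hP0 hPN hP1 hA0 hAM hA1
          (ta_pointwise_of_ta y N P hy0.le hPN htaP) (ta_pointwise_of_ta y M A hy0.le hAM htaA)
          (fun j'' _ => hdecP j'') (fun j'' _ => decAt_of_top_ge M y A hy0 hy1 hA0 hAM hA1 htopA j'') j' hj
      · exact decAt_of_top_le (N + M) (lconv N M P A) (lconv_nonneg _ _ _ _ hP0 hA0) (fun k hk => lconv_eq_zero _ _ _ _ k hk)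
          (sum_lconv _ _ _ _ hP1 hA1) y hy1
          (ta_pointwise_of_ta y (N + M) (lconv N M P A) hy0.le (fun k hk => lconv_eq_zero _ _ _ _ k hk) htaPA)
          j' (not_lt.1 hj)

/-- **THE FAR ROW FOR ITERATED CONVOLUTIONS OF HEAVY-TOP LAWS (every floor)**: `HTProd y N P`, `0 < y < 1`, `2j < mean P` ⟹
`y ≤ P{j+1, …, N}` — the law-level form of `Quant.far_indepLegs` (census-1 g6) for the products that the hull programme uses, obtained here
from DEC at every layer (`tail_ge_of_decAt`). [this work] -/
theorem HTProd.row {y : ℝ} {N : ℕ} {P : ℕ → ℝ} (h : HTProd y N P) (hy0 : 0 < y) (hy1 : y < 1) (j : ℕ)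
    (hdom : (2 * j : ℝ) < ∑ k ∈ Finset.range (N + 1), (k : ℝ) * P k) :
    y ≤ ∑ k ∈ Finset.Ico (j + 1) (N + 1), P k :=
  tail_ge_of_decAt y j N P hy1.le ((h.top_pos_ta_decAt hy0 hy1).2.2 j) hdom

/-! ### Rows pass through a gate and through mixtures -/

/-- **row transfer through a gate**: for `P ≥ 0` on `{0..N}`, `N ≤ M`, `0 < s` and the row `x/s ≤ P{j+1..N}`, the gated law has
`x ≤ (gate P s){j+1..M}` (the zero atom never enters a tail from `j+1 ≥ 1`). [this work] -/
theorem row_gate (x s : ℝ) (N M j : ℕ) (P : ℕ → ℝ) (hs0 : 0 < s) (hNM : N ≤ M) (hP0 : ∀ k, 0 ≤ P k)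
    (hrow : x / s ≤ ∑ k ∈ Finset.Ico (j + 1) (N + 1), P k) :
    x ≤ ∑ k ∈ Finset.Ico (j + 1) (M + 1), gate P s k := by
  have e : ∀ k ∈ Finset.Ico (j + 1) (M + 1), gate P s k = s * P k := by
    intro k hk
    rw [Finset.mem_Ico] at hk
    rw [gate_apply, if_neg (by omega), mul_zero, add_zero]
  rw [Finset.sum_congr rfl e, ← Finset.mul_sum]
  have hsub : ∑ k ∈ Finset.Ico (j + 1) (N + 1), P k ≤ ∑ k ∈ Finset.Ico (j + 1) (M + 1), P k :=
    Finset.sum_le_sum_of_subset_of_nonneg (Finset.Ico_subset_Ico_right (by omega)) (fun k _ _ => hP0 k)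
  have hx : x = s * (x / s) := by field_simp
  rw [hx]
  exact mul_le_mul_of_nonneg_left (hrow.trans hsub) hs0.le

/-- **rows are preserved by mixtures** (at a common layer). [this work] -/
theorem row_mixture {ι : Type} [Fintype ι] (x : ℝ) (M j : ℕ) (μ : ℕ → ℝ) (w : ι → ℝ) (ν : ι → ℕ → ℝ)
    (hw0 : ∀ i, 0 ≤ w i) (hw1 : ∑ i, w i = 1) (hμ : ∀ h, μ h = ∑ i, w i * ν i h)
    (hrow : ∀ i, x ≤ ∑ k ∈ Finset.Ico (j + 1) (M + 1), ν i k) :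
    x ≤ ∑ k ∈ Finset.Ico (j + 1) (M + 1), μ k := by
  calc x = ∑ i, w i * x := by rw [← Finset.sum_mul, hw1, one_mul]
    _ ≤ ∑ i, w i * ∑ k ∈ Finset.Ico (j + 1) (M + 1), ν i k :=
        Finset.sum_le_sum fun i _ => mul_le_mul_of_nonneg_left (hrow i) (hw0 i)
    _ = ∑ k ∈ Finset.Ico (j + 1) (M + 1), μ k := by
        simp_rw [Finset.mul_sum]
        rw [Finset.sum_comm]
        exact Finset.sum_congr rfl fun k _ => (hμ k).symm

/-! ### Rows of a gated heavy-top-product mixture -/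

/-- **the far-relay row of a finite mixture of gated heavy-top products of a common mean** `T > 2j` at floor `x`: each component
`gate (P i) (s i)` (`x < s i ≤ 1`, `HTProd (x / s i) (N i) (P i)`, `N i ≤ M`, `s i · mean (P i) = T`) has inner mean `T / s i ≥ T > 2j`,
so `HTProd.row` at floor `x / s i`, `row_gate` and `row_mixture` give `x ≤ μ{j+1..M}`. [this work] -/
theorem row_of_gatedHTProdMixture {ι : Type} [Fintype ι] (x : ℝ) (M : ℕ) (μ : ℕ → ℝ) (w s : ι → ℝ) (N : ι → ℕ)
    (P : ι → ℕ → ℝ) (hx0 : 0 < x) (hw0 : ∀ i, 0 ≤ w i) (hw1 : ∑ i, w i = 1) (hs : ∀ i, x < s i ∧ s i ≤ 1)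
    (hP : ∀ i, HTProd (x / s i) (N i) (P i)) (hNM : ∀ i, N i ≤ M)
    (hmean : ∀ i, s i * (∑ h ∈ Finset.range (N i + 1), (h : ℝ) * P i h) = ∑ h ∈ Finset.range (M + 1), (h : ℝ) * μ h)
    (hmix : ∀ h, μ h = ∑ i, w i * gate (P i) (s i) h)
    (j : ℕ) (hdom : (2 * j : ℝ) < ∑ k ∈ Finset.range (M + 1), (k : ℝ) * μ k) :
    x ≤ ∑ k ∈ Finset.Ico (j + 1) (M + 1), μ k := by
  refine row_mixture x M j μ w (fun i => gate (P i) (s i)) hw0 hw1 hmix fun i => ?_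
  have hs0 : 0 < s i := hx0.trans (hs i).1
  have hy0 : 0 < x / s i := div_pos hx0 hs0
  have hy1 : x / s i < 1 := (div_lt_one hs0).2 (hs i).1
  obtain ⟨hP0, -, -⟩ := (hP i).lawFacts
  have hmP : 0 ≤ ∑ k ∈ Finset.range (N i + 1), (k : ℝ) * P i k :=
    Finset.sum_nonneg fun k _ => mul_nonneg (Nat.cast_nonneg k) (hP0 k)
  have hdomP : (2 * j : ℝ) < ∑ k ∈ Finset.range (N i + 1), (k : ℝ) * P i k := by
    calc (2 * j : ℝ) < ∑ k ∈ Finset.range (M + 1), (k : ℝ) * μ k := hdom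
      _ = s i * ∑ k ∈ Finset.range (N i + 1), (k : ℝ) * P i k := (hmean i).symm
      _ ≤ 1 * ∑ k ∈ Finset.range (N i + 1), (k : ℝ) * P i k := mul_le_mul_of_nonneg_right (hs i).2 hmP
      _ = _ := one_mul _
  exact row_gate x (s i) (N i) M j (P i) hs0 (hNM i) hP0 ((hP i).row hy0 hy1 j hdomP)

end LawDec

end Quant

end Summit.CriticalPhenomena.PercolationContinuityZ3.Theorems
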